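import Summits.Ventures.PercRepro.CoreFiveCounts

/-!
# PercRepro — the sets of rank `≤ 3` with `≥ 5` points, by `4`-circuits per plane (p2, gen 12)

Without any nullity hypothesis: on a simple matroid with (C1) (lines have `≤ 3` points) and (C2) (planes have `≤ 7`
points), a plane `P` with `k ≥ 5` points contains at least `C(k,5)/(k − 4)` four-circuits whose closure is `P`
(every `5`-subset of `P` contains one, and a `4`-circuit lies in `k − 4` of the `5`-subsets) — `≥ 1, 3, 7` for
`k = 5, 6, 7` — while it carries `C(k,5) + C(k,6) + C(k,7) = 1, 7, 29` subsets with `≥ 5` points. Since the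
`4`-circuits of distinct planes are distinct, `7·#{sets of rank ≤ 3 with ≥ 5 points} ≤ 29·s₄`.

* `ncard_subsets_five_le_le_choose` — `#{X ⊆ P : 5 ≤ |X|} ≤ C(|P|,5) + C(|P|,6) + C(|P|,7)` for `|P| ≤ 7`;
* `choose_five_le_mul_card_circuits_closure_eq` — `C(|P|,5) ≤ (|P| − 4)·#{4-circuits C : cl C = P}`;
* **`seven_mul_ncard_big_sets_le`** — `7·#{X ⊆ E : r(X) ≤ 3 ∧ 5 ≤ |X|} ≤ 29·s₄`.
Imports `CoreFiveCounts`. Axioms: standard.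
-/

namespace PercRepro
namespace CoreFour

open Set Finset

variable {α : Type} {M : Matroid α}

/-- A finite set `P` with `≤ 7` points has at most `C(|P|,5) + C(|P|,6) + C(|P|,7)` subsets with `≥ 5` points. -/
theorem ncard_subsets_five_le_le_choose {P : Set α} (hP : P.Finite) (h7 : P.ncard ≤ 7) :
    {X : Set α | X ⊆ P ∧ 5 ≤ X.ncard}.ncard ≤ P.ncard.choose 5 + P.ncard.choose 6 + P.ncard.choose 7 := by
  classical
  set F := hP.toFinset with hF
  have hPF : (F : Set α) = P := Set.Finite.coe_toFinset _
  have hFc : F.card = P.ncard := (Set.ncard_eq_toFinset_card _ _).symm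
  have hcover : {X : Set α | X ⊆ P ∧ 5 ≤ X.ncard} ⊆
      ({X : Set α | X ⊆ (F : Set α) ∧ X.ncard = 5} ∪ {X : Set α | X ⊆ (F : Set α) ∧ X.ncard = 6}) ∪
        {X : Set α | X ⊆ (F : Set α) ∧ X.ncard = 7} := by
    rintro X ⟨hXP, hX5⟩
    have hle : X.ncard ≤ P.ncard := Set.ncard_le_ncard hXP hP
    rw [← hPF] at hXP
    rcases (show X.ncard = 5 ∨ X.ncard = 6 ∨ X.ncard = 7 by omega) with h | h | h
    · exact Or.inl (Or.inl ⟨hXP, h⟩)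
    · exact Or.inl (Or.inr ⟨hXP, h⟩)
    · exact Or.inr ⟨hXP, h⟩
  have hfin : (({X : Set α | X ⊆ (F : Set α) ∧ X.ncard = 5} ∪ {X : Set α | X ⊆ (F : Set α) ∧ X.ncard = 6}) ∪
        {X : Set α | X ⊆ (F : Set α) ∧ X.ncard = 7}).Finite :=
    ((F.finite_toSet.finite_subsets.subset (fun X hX => hX.1)).union
      (F.finite_toSet.finite_subsets.subset (fun X hX => hX.1))).union
      (F.finite_toSet.finite_subsets.subset (fun X hX => hX.1))
  calc {X : Set α | X ⊆ P ∧ 5 ≤ X.ncard}.ncard ≤ _ := Set.ncard_le_ncard hcover hfin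
    _ ≤ ({X : Set α | X ⊆ (F : Set α) ∧ X.ncard = 5}.ncard + {X : Set α | X ⊆ (F : Set α) ∧ X.ncard = 6}.ncard) +
          {X : Set α | X ⊆ (F : Set α) ∧ X.ncard = 7}.ncard := by
        refine (Set.ncard_union_le _ _).trans ?_
        gcongr
        exact Set.ncard_union_le _ _
    _ = (F.card.choose 5 + F.card.choose 6) + F.card.choose 7 := by
        rw [ncard_subsets_ncard_eq, ncard_subsets_ncard_eq, ncard_subsets_ncard_eq]
    _ = _ := by rw [hFc]

/-- **A plane with `k` points carries at least `C(k,5)/(k − 4)` four-circuits with closure the plane**: every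
`5`-subset contains a `4`-circuit (whose closure is `P`, a flat of rank `3`), and a `4`-circuit lies in exactly
`k − 4` five-subsets. -/
theorem choose_five_le_mul_card_circuits_closure_eq [M.Finite]
    (hs : ∀ e ∈ M.E, ∀ f ∈ M.E, e ≠ f → M.eRk {e, f} = 2)
    (hC1 : ∀ L ⊆ M.E, M.eRk L = 2 → L.ncard ≤ 3) {P : Set α} (hPE : P ⊆ M.E) (hPr : M.eRk P = 3)
    (hPcl : M.closure P = P) :
    P.ncard.choose 5 ≤ (P.ncard - 4) *
      ((PercRepro.Matroid.circuitsEq_finite (M := M) 4).toFinset.filter (fun C => M.closure C = P)).card := by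
  classical
  have hPfin : P.Finite := M.ground_finite.subset hPE
  set Pf := hPfin.toFinset with hPf
  have hPfc : Pf.card = P.ncard := (Set.ncard_eq_toFinset_card _ _).symm
  have hPfP : (Pf : Set α) = P := Set.Finite.coe_toFinset _
  set Y5 := Finset.powersetCard 5 Pf with hY5
  have hmemY5 : ∀ Y ∈ Y5, (↑Y : Set α) ⊆ P ∧ Y.card = 5 := by
    intro Y hY
    rw [hY5, Finset.mem_powersetCard] at hY
    exact ⟨by rw [← hPfP]; exact_mod_cast hY.1, hY.2⟩
  have hex : ∀ Y ∈ Y5, ∃ C ⊆ (↑Y : Set α), M.IsCircuit C ∧ C.ncard = 4 := by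
    intro Y hY
    obtain ⟨hYP, hY5'⟩ := hmemY5 Y hY
    have hY5'' : (↑Y : Set α).ncard = 5 := by rw [Set.ncard_coe_finset]; exact hY5'
    exact exists_isCircuit_four_of_five hs hC1 (hYP.trans hPE) hY5'' (by rw [← hPr]; exact M.eRk_mono hYP)
  let f : Finset α → Set α := fun Y =>
    if h : ∃ C ⊆ (↑Y : Set α), M.IsCircuit C ∧ C.ncard = 4 then Classical.choose h else ∅
  have hf : ∀ Y ∈ Y5, f Y ⊆ (↑Y : Set α) ∧ M.IsCircuit (f Y) ∧ (f Y).ncard = 4 := by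
    intro Y hY
    have h := hex Y hY
    simp only [f, dif_pos h]
    exact Classical.choose_spec h
  -- the image lies in the `4`-circuits with closure `P`
  have himage : Y5.image f ⊆
      (PercRepro.Matroid.circuitsEq_finite (M := M) 4).toFinset.filter (fun C => M.closure C = P) := by
    intro C hC
    rw [Finset.mem_image] at hC
    obtain ⟨Y, hY, rfl⟩ := hC
    obtain ⟨hfY, hfc, hf4⟩ := hf Y hY
    have hCP : f Y ⊆ P := hfY.trans (hmemY5 Y hY).1
    rw [Finset.mem_filter, Set.Finite.mem_toFinset]
    refine ⟨⟨hfc, hf4⟩, ?_⟩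
    have hCfin : (f Y).Finite := M.ground_finite.subset hfc.subset_ground
    have hCr : M.eRk (f Y) = 3 := by
      have h := hfc.eRk_add_one_eq
      rw [← hCfin.cast_ncard_eq, hf4] at h
      obtain ⟨r, hr⟩ := exists_eRk_eq_nat (M := M) (f Y)
      rw [hr] at h ⊢
      have : r + 1 = 4 := by exact_mod_cast h
      have : r = 3 := by omega
      rw [this]; rfl
    have hcl : M.closure (f Y) = M.closure P :=
      (M.isRkFinite_of_finite hCfin).closure_eq_closure_of_subset_of_eRk_ge_eRk hCP (by rw [hCr, hPr])
    rw [hcl, hPcl]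
  -- each `4`-circuit is the image of at most `|P| − 4` five-subsets
  have hfib : ∀ C ∈ Y5.image f, (Y5.filter (fun Y => f Y = C)).card ≤ P.ncard - 4 := by
    intro C hC
    rw [Finset.mem_image] at hC
    obtain ⟨Y₀, hY₀, rfl⟩ := hC
    obtain ⟨hfY₀, hfc₀, hf4₀⟩ := hf Y₀ hY₀
    have hCfin : (f Y₀).Finite := M.ground_finite.subset hfc₀.subset_ground
    set Cf := hCfin.toFinset with hCf
    have hCfc : Cf.card = 4 := by rw [hCf, ← Set.ncard_eq_toFinset_card _ hCfin]; exact hf4₀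
    have hCfP : Cf ⊆ Pf := by
      intro x hx
      rw [hCf, Set.Finite.mem_toFinset] at hx
      rw [hPf, Set.Finite.mem_toFinset]
      exact (hfY₀.trans (hmemY5 Y₀ hY₀).1) hx
    have hsub : Y5.filter (fun Y => f Y = f Y₀) ⊆ (Pf \ Cf).image (fun x => insert x Cf) := by
      intro Y hY
      rw [Finset.mem_filter] at hY
      obtain ⟨hYY5, hYf⟩ := hY
      obtain ⟨hfY, _, _⟩ := hf Y hYY5
      rw [hYf] at hfY
      have hCfY : Cf ⊆ Y := by
        intro x hx
        rw [hCf, Set.Finite.mem_toFinset] at hx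
        exact_mod_cast hfY hx
      have hY5' := (hmemY5 Y hYY5).2
      have hYP : Y ⊆ Pf := by
        intro x hx
        rw [hPf, Set.Finite.mem_toFinset]
        exact (hmemY5 Y hYY5).1 (Finset.mem_coe.2 hx)
      have hdiff : (Y \ Cf).card = 1 := by
        rw [Finset.card_sdiff, Finset.inter_eq_left.2 hCfY, hY5', hCfc]
      obtain ⟨x, hx⟩ := Finset.card_eq_one.1 hdiff
      rw [Finset.mem_image]
      refine ⟨x, ?_, ?_⟩
      · have hxY : x ∈ Y \ Cf := by rw [hx]; exact Finset.mem_singleton_self x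
        rw [Finset.mem_sdiff] at hxY ⊢
        exact ⟨hYP hxY.1, hxY.2⟩
      · rw [← Finset.union_sdiff_of_subset hCfY, hx, Finset.union_comm, Finset.insert_eq]
    calc (Y5.filter (fun Y => f Y = f Y₀)).card ≤ ((Pf \ Cf).image (fun x => insert x Cf)).card :=
          Finset.card_le_card hsub
      _ ≤ (Pf \ Cf).card := Finset.card_image_le
      _ = P.ncard - 4 := by rw [Finset.card_sdiff, Finset.inter_eq_left.2 hCfP, hPfc, hCfc]
  have h := Finset.card_le_mul_card_image Y5 (P.ncard - 4) hfib
  rw [hY5, Finset.card_powersetCard, hPfc] at h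
  calc P.ncard.choose 5 ≤ (P.ncard - 4) * (Y5.image f).card := h
    _ ≤ _ := Nat.mul_le_mul_left _ (Finset.card_le_card himage)

/-- **`7·#{sets of rank ≤ 3 with ≥ 5 points} ≤ 29·s₄`** on a simple matroid with (C1) and (C2): every such set lies
in the closure of a `4`-circuit inside it, a plane with `k ≤ 7` points, which carries `≤ C(k,5) + C(k,6) + C(k,7)` such
sets and `≥ C(k,5)/(k − 4)` four-circuits of its own. -/
theorem seven_mul_ncard_big_sets_le [M.Finite] (hs : ∀ e ∈ M.E, ∀ f ∈ M.E, e ≠ f → M.eRk {e, f} = 2)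
    (hC1 : ∀ L ⊆ M.E, M.eRk L = 2 → L.ncard ≤ 3) (hC2 : ∀ P ⊆ M.E, M.eRk P = 3 → P.ncard ≤ 7) :
    7 * {X : Set α | X ⊆ M.E ∧ M.eRk X ≤ 3 ∧ 5 ≤ X.ncard}.ncard ≤ 29 * (PercRepro.Matroid.circuitsEq M 4).ncard := by
  classical
  have h4fin : (PercRepro.Matroid.circuitsEq M 4).Finite := PercRepro.Matroid.circuitsEq_finite 4
  set F₄ := h4fin.toFinset with hF₄
  set Pl := F₄.image (fun C => M.closure C) with hPldef
  have hEsub : {X : Set α | X ⊆ M.E}.Finite := M.ground_finite.finite_subsets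
  let g : Set α → Finset (Set α) := fun P => hEsub.toFinset.filter (fun X => X ⊆ P ∧ 5 ≤ X.ncard)
  have hcirc_rank : ∀ C, M.IsCircuit C → C.ncard = 4 → M.eRk C = 3 := by
    intro C hC hC4
    have hCfin : C.Finite := M.ground_finite.subset hC.subset_ground
    have h := hC.eRk_add_one_eq
    rw [← hCfin.cast_ncard_eq, hC4] at h
    obtain ⟨r, hr⟩ := exists_eRk_eq_nat (M := M) C
    rw [hr] at h ⊢
    have : r + 1 = 4 := by exact_mod_cast h
    have : r = 3 := by omega
    rw [this]; rfl
  -- the planes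
  have hPl : ∀ P ∈ Pl, P ⊆ M.E ∧ M.eRk P = 3 ∧ M.closure P = P ∧ 4 ≤ P.ncard ∧ P.ncard ≤ 7 := by
    intro P hP
    rw [hPldef, Finset.mem_image] at hP
    obtain ⟨C, hC, rfl⟩ := hP
    rw [hF₄, Set.Finite.mem_toFinset] at hC
    have hclr : M.eRk (M.closure C) = 3 := by rw [M.eRk_closure_eq]; exact hcirc_rank C hC.1 hC.2
    have hCcl : C ⊆ M.closure C := M.subset_closure C hC.1.subset_ground
    have hclfin : (M.closure C).Finite := M.ground_finite.subset (M.closure_subset_ground C)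
    refine ⟨M.closure_subset_ground C, hclr, M.closure_closure C, ?_,
      hC2 _ (M.closure_subset_ground C) hclr⟩
    rw [← hC.2]
    exact Set.ncard_le_ncard hCcl hclfin
  -- every big set of rank `≤ 3` lies in some plane of `Pl`
  have hcover : {X : Set α | X ⊆ M.E ∧ M.eRk X ≤ 3 ∧ 5 ≤ X.ncard} ⊆ ↑(Pl.biUnion g) := by
    rintro X ⟨hXE, hXr, hX5⟩
    obtain ⟨Y, hYX, hY5⟩ := Set.exists_subset_card_eq hX5
    have hYE : Y ⊆ M.E := hYX.trans hXE
    obtain ⟨C, hCY, hC, hC4⟩ := exists_isCircuit_four_of_five hs hC1 hYE hY5 ((M.eRk_mono hYX).trans hXr)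
    have hCX : C ⊆ X := hCY.trans hYX
    have hCfin : C.Finite := M.ground_finite.subset hC.subset_ground
    have hCr : M.eRk C = 3 := hcirc_rank C hC hC4
    have hcl : M.closure C = M.closure X :=
      (M.isRkFinite_of_finite hCfin).closure_eq_closure_of_subset_of_eRk_ge_eRk hCX (by rw [hCr]; exact hXr)
    have hXcl : X ⊆ M.closure C := by rw [hcl]; exact M.subset_closure X hXE
    rw [Finset.mem_coe, Finset.mem_biUnion]
    refine ⟨M.closure C, ?_, ?_⟩
    · rw [hPldef, Finset.mem_image]
      exact ⟨C, by rw [hF₄, Set.Finite.mem_toFinset]; exact ⟨hC, hC4⟩, rfl⟩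
    · simp only [g, Finset.mem_filter, Set.Finite.mem_toFinset, Set.mem_setOf_eq]
      exact ⟨hXE, hXcl, hX5⟩
  -- per plane: `7·(g P).card ≤ 29·#{4-circuits with closure P}`
  have hper : ∀ P ∈ Pl, 7 * (g P).card ≤ 29 * (F₄.filter (fun C => M.closure C = P)).card := by
    intro P hP
    obtain ⟨hPE, hPr, hPcl, hP4, hP7⟩ := hPl P hP
    have hPfin : P.Finite := M.ground_finite.subset hPE
    have hg : (g P).card ≤ P.ncard.choose 5 + P.ncard.choose 6 + P.ncard.choose 7 := by
      have hfinS : {X : Set α | X ⊆ P ∧ 5 ≤ X.ncard}.Finite := hEsub.subset (fun X hX => hX.1.trans hPE)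
      have hsub : (↑(g P) : Set (Set α)) ⊆ {X : Set α | X ⊆ P ∧ 5 ≤ X.ncard} := by
        intro X hX
        simp only [g, Finset.coe_filter, Set.Finite.mem_toFinset, Set.mem_setOf_eq] at hX
        exact ⟨hX.2.1, hX.2.2⟩
      have := Set.ncard_le_ncard hsub hfinS
      rw [Set.ncard_coe_finset] at this
      exact this.trans (ncard_subsets_five_le_le_choose hPfin hP7)
    have hc := choose_five_le_mul_card_circuits_closure_eq hs hC1 hPE hPr hPcl
    rw [← hF₄] at hc
    generalize hk : P.ncard = k at hg hc hP4 hP7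
    generalize (F₄.filter (fun C => M.closure C = P)).card = c at hc ⊢
    generalize (g P).card = a at hg ⊢
    interval_cases k <;>
      norm_num [Nat.choose_eq_factorial_div_factorial, Nat.factorial, Nat.choose_eq_zero_of_lt] at hg hc ⊢ <;>
      omega
  -- sum over the planes
  have hsum : F₄.card = ∑ P ∈ Pl, (F₄.filter (fun C => M.closure C = P)).card :=
    Finset.card_eq_sum_card_image (fun C => M.closure C) F₄
  calc 7 * {X : Set α | X ⊆ M.E ∧ M.eRk X ≤ 3 ∧ 5 ≤ X.ncard}.ncard
      ≤ 7 * (↑(Pl.biUnion g) : Set (Set α)).ncard :=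
        Nat.mul_le_mul_left _ (Set.ncard_le_ncard hcover (Finset.finite_toSet _))
    _ = 7 * (Pl.biUnion g).card := by rw [Set.ncard_coe_finset]
    _ ≤ 7 * ∑ P ∈ Pl, (g P).card := Nat.mul_le_mul_left _ Finset.card_biUnion_le
    _ = ∑ P ∈ Pl, 7 * (g P).card := Finset.mul_sum _ _ _
    _ ≤ ∑ P ∈ Pl, 29 * (F₄.filter (fun C => M.closure C = P)).card := Finset.sum_le_sum hper
    _ = 29 * ∑ P ∈ Pl, (F₄.filter (fun C => M.closure C = P)).card := (Finset.mul_sum _ _ _).symm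
    _ = 29 * F₄.card := by rw [← hsum]
    _ = 29 * (PercRepro.Matroid.circuitsEq M 4).ncard := by rw [hF₄, ← Set.ncard_eq_toFinset_card _ h4fin]

end CoreFour
end PercRepro
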